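import Summits.CriticalPhenomena.PercolationContinuityZ3.Theorems.PercNearOneGluingNoHeavyLowerTailQuantitativeS5Universality
import Summits.CriticalPhenomena.PercolationContinuityZ3.Theorems.PercNearOneGluingNoHeavyLowerTailQuantitativeS5PocketDichotomy
import HarnessLib

/-!
# The functional-free DICHOTOMY of the (S5) rank tuples on a support graph (row M2-R35, packaged)

Support file (`--supports stmt-CriticalPhenomena-4575`), prover seat `prim-rate-mine-2` (lane prim-rate, constants-miner (c), BENCH rows
M2-R35 / M2-R35-LEAN; `run/shared/lean/prim/prim-rate/prim-rate-mine-2/PROOFS.md` §P34–§P35).  No definitions, no named facts, no sorries;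
standard axioms.

Weights non-degenerate on their support `E`; relays `T` with an injective rank `r` and its minimal relay `x₁`; observers `o ≠ v` off `T`.  The
OBSERVER'S POCKET is the set of vertices reached from `o` through pairs of `E` avoiding `T ∪ {v}` — written inline as a reachability set, no
definition.  Exactly one of two things happens, and neither mentions a functional:

* `CSH.s5dMargin_nil_nonneg_of_forall_not_adj` — if NO relay other than `x₁` is adjacent (in `E`) to the pocket, then
  `0 ≤ s5dMargin w T r [] o v F` for EVERY monotone `F` (no compatibility; `CSH.s5dMargin_nonneg_of_pocket`);
* `CSH.s5dMargin_nil_pos_of_adj` — if SOME relay `b ≠ x₁` joined to `x₁` is adjacent to the pocket, then `s5dMargin w T r [] o v 1{x₁ ∈ ·} < 0`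
  and `0 < s5dMargin w T r [] o v F` for every monotone `F` with which `r` is strictly compatible (`CSH.s5dMargin_nil_pos_of_walk_certificate`).
[cite: KozmaNitzan2024, Conj. 4 (p. 32)] [cite: Grimmett1999, §2.2]
-/

noncomputable section

namespace Summit.CriticalPhenomena.PercolationContinuityZ3.Theorems

open MeasureTheory Set Literature.Probability.LatticeModels Literature.Probability.Percolation
open scoped Classical

namespace CSH

variable {n : ℕ}

/-- **Nonnegative ranks.**  Weights `< 1` supported on `E`; `o ≠ v` off `T`; `r` injective with minimal relay `x₁ ∈ T`.  If every relay adjacent in `E`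
to a vertex of the observer's pocket `{y | o ⇝ y through pairs of E avoiding T ∪ {v}}` is `x₁`, then `0 ≤ s5dMargin w T r [] o v F` for every
monotone `F`. [cite: KozmaNitzan2024, Conj. 4 (p. 32)] -/
theorem s5dMargin_nil_nonneg_of_forall_not_adj (w : Sym2 (Fin n) → unitInterval) (hw : ∀ e, w e < 1) (E : Set (Sym2 (Fin n)))
    (hE0 : ∀ f, f ∉ E → (w f : ℝ) = 0) (T : Finset (Fin n)) (r : Fin n → ℕ) (hr : Set.InjOn r ↑T)
    (x₁ : Fin n) (hx : x₁ ∈ T) (hmin : ∀ t ∈ T, r x₁ ≤ r t) (o v : Fin n) (hoT : o ∉ T) (hvT : v ∉ T) (hov : o ≠ v)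
    (hpocket : ∀ y b : Fin n,
      (openGraph {f | f ∈ E ∧ ∀ z ∈ f, z ∉ T ∧ z ≠ v}).Reachable o y → b ∈ T → s(y, b) ∈ E → b = x₁)
    (F : Set (Fin n) → ℝ) (hF : ∀ S S' : Set (Fin n), S ⊆ S' → F S ≤ F S') :
    0 ≤ s5dMargin w T r [] o v F := by
  set K : Set (Fin n) := {y | (openGraph {f | f ∈ E ∧ ∀ z ∈ f, z ∉ T ∧ z ≠ v}).Reachable o y} with hKdef
  -- vertices of the pocket are off `T` and differ from `v`
  have hKprop : ∀ y ∈ K, y ∉ T ∧ y ≠ v := by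
    intro y hy
    exact forall_reachable_of_edges (S := {f | f ∈ E ∧ ∀ z ∈ f, z ∉ T ∧ z ≠ v}) (fun z => z ∉ T ∧ z ≠ v) ⟨hoT, hov⟩
      (fun f hf z hz => hf.2 z hz) hy
  have hoK : o ∈ K := SimpleGraph.Reachable.refl _
  have hvK : v ∉ K := fun h => (hKprop v h).2 rfl
  have hK : ∀ p q : Fin n, s(p, q) ∈ E → p ∈ K → q ∈ K ∨ q = v ∨ q = x₁ := by
    intro p q hpq hp
    by_cases hqv : q = v
    · exact Or.inr (Or.inl hqv)
    by_cases hqT : q ∈ T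
    · exact Or.inr (Or.inr (hpocket p q hp hqT hpq))
    by_cases hpq' : p = q
    · exact Or.inl (hpq' ▸ hp)
    left
    have hadj : (openGraph {f | f ∈ E ∧ ∀ z ∈ f, z ∉ T ∧ z ≠ v}).Adj p q := by
      rw [openGraph_adj]
      refine ⟨⟨hpq, fun z hz => ?_⟩, hpq'⟩
      rcases Sym2.mem_iff.1 hz with rfl | rfl
      · exact hKprop _ hp
      · exact ⟨hqT, hqv⟩
    exact SimpleGraph.Reachable.trans hp hadj.reachable
  exact s5dMargin_nonneg_of_pocket w hw E hE0 o v x₁ hov K hoK hvK hK T r [] F hF hr hx hmin hoT hvT List.nodup_nil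
    (fun d hd => absurd hd List.not_mem_nil) (fun t ht htK => (hKprop t htK).1 ht) (fun d hd => absurd hd List.not_mem_nil)

/-- **Strict ranks.**  Weights non-degenerate on the support `E`; `o ≠ v` off `T`; `r` injective with minimal relay `x₁ ∈ T`.  If some relay
`b ≠ x₁`, joined to `x₁` in `(V, E)`, is adjacent in `E` to a vertex of the observer's pocket, then `s5dMargin w T r [] o v 1{x₁ ∈ ·} < 0` and
`0 < s5dMargin w T r [] o v F` for every monotone `F` with which `r` is strictly compatible. [cite: KozmaNitzan2024, Conj. 4 (p. 32)] -/
theorem s5dMargin_nil_pos_of_adj (w : Sym2 (Fin n) → unitInterval) (E : Set (Sym2 (Fin n)))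
    (hE0 : ∀ f, f ∉ E → (w f : ℝ) = 0) (hE1 : ∀ f ∈ E, 0 < (w f : ℝ) ∧ (w f : ℝ) < 1)
    (T : Finset (Fin n)) (r : Fin n → ℕ) (hr : Set.InjOn r ↑T) (x₁ : Fin n) (hx : x₁ ∈ T) (hmin : ∀ t ∈ T, r x₁ ≤ r t)
    (o v : Fin n) (hoT : o ∉ T) (hvT : v ∉ T) (hov : o ≠ v)
    (y b : Fin n) (hy : (openGraph {f | f ∈ E ∧ ∀ z ∈ f, z ∉ T ∧ z ≠ v}).Reachable o y) (hb : b ∈ T) (hbx : b ≠ x₁)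
    (hyb : s(y, b) ∈ E) (hbx₁ : (openGraph E).Reachable b x₁) :
    s5dMargin w T r [] o v (fun S : Set (Fin n) => if x₁ ∈ S then (1 : ℝ) else 0) < 0 ∧
      ∀ F : Set (Fin n) → ℝ, (∀ S S' : Set (Fin n), S ⊆ S' → F S ≤ F S') →
        (∀ a ∈ T, ∀ a' ∈ T, r a < r a' →
          ∫ ω, F (openCluster ω a) ∂(prodBernoulli w) < ∫ ω, F (openCluster ω a') ∂(prodBernoulli w)) →
        0 < s5dMargin w T r [] o v F := by
  have hKprop : ∀ z, (openGraph {f | f ∈ E ∧ ∀ z ∈ f, z ∉ T ∧ z ≠ v}).Reachable o z → z ∉ T ∧ z ≠ v := by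
    intro z hz
    exact forall_reachable_of_edges (S := {f | f ∈ E ∧ ∀ z ∈ f, z ∉ T ∧ z ≠ v}) (fun z => z ∉ T ∧ z ≠ v) ⟨hoT, hov⟩
      (fun f hf z hz => hf.2 z hz) hz
  -- an `E`-walk from `o` to `b` whose interior lies in the pocket
  obtain ⟨P⟩ := hy
  have hyb' : y ≠ b := fun h => (hKprop y ⟨P⟩).1 (h ▸ hb)
  set P' : (openGraph E).Walk o y := P.transfer (openGraph E) (fun f hf => by
    have h := P.edges_subset_edgeSet hf
    rw [openGraph, SimpleGraph.edgeSet_fromEdgeSet] at h ⊢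
    exact ⟨h.1.1, h.2⟩) with hP'
  have hadj : (openGraph E).Adj y b := (openGraph_adj _ _ _).2 ⟨hyb, hyb'⟩
  set W : (openGraph E).Walk o b := P'.append (SimpleGraph.Walk.cons hadj SimpleGraph.Walk.nil) with hWdef
  have hPsupp : ∀ z ∈ P.support, z ∉ T ∧ z ≠ v := fun z hz => hKprop z (P.takeUntil z hz).reachable
  have hW : ∀ z ∈ W.support, z ≠ o → z ≠ b → z ∉ T ∧ z ≠ v := by
    intro z hz _ hzb
    rw [hWdef, SimpleGraph.Walk.support_append] at hz
    rcases List.mem_append.1 hz with hz | hz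
    · rw [hP', SimpleGraph.Walk.support_transfer] at hz
      exact hPsupp z hz
    · simp only [SimpleGraph.Walk.support_cons, SimpleGraph.Walk.support_nil, List.tail_cons, List.mem_singleton] at hz
      exact absurd hz hzb
  have hneg := s5dMargin_nil_connFun_firstRelay_neg_of_walk w E hE0 hE1 T r x₁ hx hmin o v hoT hvT hov b hb hbx hbx₁ W hW
  exact ⟨hneg, fun F hF hcompat =>
    s5dMargin_nil_pos_of_walk_certificate w E hE0 hE1 T r hr x₁ hx hmin o v hoT hvT hov b hb hbx hbx₁ W hW F hF hcompat⟩

end CSH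

end Summit.CriticalPhenomena.PercolationContinuityZ3.Theorems

end
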